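import Summits.Ventures.CertifiedManyBodySolver.Rows.TorusCeilingHomTwist
import HarnessLib

/-!
# Torus ceiling — Part VIII′: twisted CRT rings, transposed presentations (`5 × 3`, `4 × 3`)

HONEST FRAMING: first certified bounds; not a superconductivity verdict; every number certified or
labelled float.
`crt53Twist_minEnergyOn_div_ge_of_window_certificate` / `crt43Twist_…`: the corollaries of Part VIII's
`homTorusTwist_minEnergyOn_div_ge_of_window_certificate` for the transposed CRT presentations
`crtHom53 = ringHom 15 ![6, 10]` and `crtHom43 = ringHom 12 ![9, 4]` (Part V), i.e. for window
certificates drawn in a `5 × 3` / `4 × 3` box (coordinate spreads `≤ (4, 2)` / `≤ (3, 2)`), EVERY uniform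
field `κ : Fin 2 → U(1)` (every boundary twist), sectors `(2n, S^z = 0)`.  With Part VIII this covers both
orientations of a support-`≤ 3 × 5` (`≤ 3 × 4`) translation + EOM window certificate, as the CAL ceiling
`CAP(≤3,5)` (`CAP(≤3,4)`) is stated for SORTED footprints.  Injectivity on the window and hop
non-degeneracy are the finite checks of Part V (`injOn_ringHom_two_of_spread`, `decide`).
[cite: Han2020Bootstrap, §3] [cite: ShastrySutherland1990] [cite: Gros1992]
-/

noncomputable section

open Matrix Finset
open Literature.MathematicalPhysics.QuantumLattice
open Literature.MathematicalPhysics.QuantumFieldTheory hiding Site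
open Literature.MathematicalPhysics.QuantumManyBody.StateRelaxation
open Literature.Probability.LatticeModels
open HubbardWave0
open scoped ComplexOrder ComplexConjugate

namespace Summit.Ventures.CertifiedManyBodySolver.Rows
section TwistedCRTTransposed

/-! ### The transposed presentations `5 × 3 = ℤ/15` (`crtHom53`) and `4 × 3 = ℤ/12` (`crtHom43`) -/

/-- **Twisted `5 × 3` torus (ring `ℤ/15`, hops `±6, ±10`: the transposed presentation `crtHom53`).**
Every window certificate with all coordinate spreads of `Λ'` at most `4` resp. `2` bounds, for EVERY boundary
twist `κ : Fin 2 → U(1)` (periodic `κᵢ^{Lᵢ} = 1`, antiperiodic `κᵢ^{Lᵢ} = −1`, or any flux), the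
energy density of `homHubbardMag crtHom53 κ t U` in every sector `(2n, S^z = 0)`, `n ≤ 15`:
`c − Σ‖aₖ‖ + (Σ_σ μ_σ)(n/15 − ν) ≤ minEnergyOn (H_κ) (szSector 2n 0) / 15`. Together with
`crt35Twist_minEnergyOn_div_ge_of_window_certificate` this covers both orientations of a support
`≤ 3 × 5` window (CAL ceiling `CAP(≤3,5)` is stated for sorted footprints).
[cite: Han2020Bootstrap, §3] [cite: ShastrySutherland1990] [cite: Gros1992] -/
theorem crt53Twist_minEnergyOn_div_ge_of_window_certificate (t U : ℝ) (κt : Fin 2 → Circle) {nh : ℕ}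
    (hn : nh ≤ Fintype.card (FermionTorus 1 15))
    {Λ Λ' : Finset (Site 2)} (hΛ : Λ ⊆ Λ')
    (hspread : ∀ x ∈ Λ', ∀ y ∈ Λ', |x 0 - y 0| ≤ (4 : ℤ) ∧ |x 1 - y 1| ≤ (2 : ℤ))
    (hclosed : ∀ x ∈ Λ, ∀ i : Fin 2, x + unitVec i ∈ Λ' ∧ x - unitVec i ∈ Λ')
    (h0 : thicken ({0} : Finset (Site 2)) 1 ⊆ Λ') (hz : (0 : Site 2) ∈ Λ')
    (μ : Fin 2 → ℝ) (ν : ℝ)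
    {m : Type*} [Fintype m] [DecidableEq m] {Λm : Matrix m m ℂ} (hΛm : Λm.PosSemidef)
    (O : m → FermionOp Λ')
    {κ : Type*} (s : Finset κ) (B : κ → FermionOp Λ)
    {ι : Type*} (tt : Finset ι) (v : ι → Site 2) (hsh : ∀ l, shiftSet (v l) Λ ⊆ Λ') (Y : ι → FermionOp Λ)
    {γ : Type*} (u : Finset γ) (b : γ → ℂ) (cw : γ → List (Orb (PolySite Λ') × Bool))
    (hcw : ∀ j ∈ u, ladderCharge (cw j) ≠ 0 ∨ ladderSpinCharge (cw j) ≠ 0)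
    {δ : Type*} (ah : Finset δ) (dc : δ → ℝ) (V : δ → FermionOp Λ')
    {κ'' : Type*} (w : Finset κ'') (a : κ'' → ℂ) (word : κ'' → List (Orb (PolySite Λ') × Bool)) {c : ℝ}
    (hcert : fermionEmbed (PolySite.incl h0) ((hubbardFermionInteraction 2 t U).meanEnergyObs 1) -
        (c : ℂ) • (1 : FermionOp Λ') -
        ∑ σ : Fin 2, ((μ σ : ℝ) : ℂ) • (nAt 0 hz σ - ((ν : ℝ) : ℂ) • (1 : FermionOp Λ')) =
      gramForm Λm O +
        (∑ k ∈ s, ((hubbardFermionInteraction 2 t U).localHamiltonian Λ' * fermionEmbed (PolySite.incl hΛ) (B k) -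
            fermionEmbed (PolySite.incl hΛ) (B k) * (hubbardFermionInteraction 2 t U).localHamiltonian Λ') +
          ∑ l ∈ tt, (fermionEmbed (PolySite.incl (hsh l)) (fermionEmbed (PolySite.shiftEmb (v l) Λ) (Y l)) -
            fermionEmbed (PolySite.incl hΛ) (Y l)) +
          ∑ j ∈ u, b j • ladderWord (cw j)) +
        (∑ m' ∈ ah, ((dc m' : ℝ) : ℂ) • ((V m')ᴴ - V m') + ∑ k ∈ w, a k • ladderWord (word k))) :
    c - ∑ k ∈ w, ‖a k‖ + (∑ σ : Fin 2, μ σ) * ((nh : ℝ) / 15 - ν) ≤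
      (homHubbardMag crtHom53 (fun _ => κt) t U).minEnergyOn (szSector (2 * nh) 0) / 15 := by
  have hInj' : Set.InjOn crtHom53 ↑Λ' :=
    injOn_ringHom_two_of_spread 15 ![6, 10] (M₀ := 4) (M₁ := 2)
      (fun a' b' h₁ h₂ h₃ h₄ h₅ => by
        simp only [Matrix.cons_val_zero, Matrix.cons_val_one] at h₅
        omega) hspread
  have hd : Function.Injective (signedHop crtHom53) := injective_signedHop_ringHom 15 ![6, 10] (by decide)
  have h := homTorusTwist_minEnergyOn_div_ge_of_window_certificate crtHom53 t U κt hd hn hΛ hclosed h0 hz hInj'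
    μ ν hΛm O s B tt v hsh Y u b cw hcw ah dc V w a word hcert
  simp only [Nat.cast_ofNat, pow_one] at h
  exact h

/-- **Twisted `4 × 3` torus (ring `ℤ/12`, hops `±9, ±4`: the transposed presentation `crtHom43`).** As
`crt34Twist_minEnergyOn_div_ge_of_window_certificate` with spreads `≤ 3`, `≤ 2` (`n ≤ 12`):
`c − Σ‖aₖ‖ + (Σ_σ μ_σ)(n/12 − ν) ≤ minEnergyOn (homHubbardMag crtHom43 κ t U) (szSector 2n 0) / 12`
for EVERY boundary twist `κ`. [cite: Han2020Bootstrap, §3] [cite: ShastrySutherland1990] -/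
theorem crt43Twist_minEnergyOn_div_ge_of_window_certificate (t U : ℝ) (κt : Fin 2 → Circle) {nh : ℕ}
    (hn : nh ≤ Fintype.card (FermionTorus 1 12))
    {Λ Λ' : Finset (Site 2)} (hΛ : Λ ⊆ Λ')
    (hspread : ∀ x ∈ Λ', ∀ y ∈ Λ', |x 0 - y 0| ≤ (3 : ℤ) ∧ |x 1 - y 1| ≤ (2 : ℤ))
    (hclosed : ∀ x ∈ Λ, ∀ i : Fin 2, x + unitVec i ∈ Λ' ∧ x - unitVec i ∈ Λ')
    (h0 : thicken ({0} : Finset (Site 2)) 1 ⊆ Λ') (hz : (0 : Site 2) ∈ Λ')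
    (μ : Fin 2 → ℝ) (ν : ℝ)
    {m : Type*} [Fintype m] [DecidableEq m] {Λm : Matrix m m ℂ} (hΛm : Λm.PosSemidef)
    (O : m → FermionOp Λ')
    {κ : Type*} (s : Finset κ) (B : κ → FermionOp Λ)
    {ι : Type*} (tt : Finset ι) (v : ι → Site 2) (hsh : ∀ l, shiftSet (v l) Λ ⊆ Λ') (Y : ι → FermionOp Λ)
    {γ : Type*} (u : Finset γ) (b : γ → ℂ) (cw : γ → List (Orb (PolySite Λ') × Bool))
    (hcw : ∀ j ∈ u, ladderCharge (cw j) ≠ 0 ∨ ladderSpinCharge (cw j) ≠ 0)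
    {δ : Type*} (ah : Finset δ) (dc : δ → ℝ) (V : δ → FermionOp Λ')
    {κ'' : Type*} (w : Finset κ'') (a : κ'' → ℂ) (word : κ'' → List (Orb (PolySite Λ') × Bool)) {c : ℝ}
    (hcert : fermionEmbed (PolySite.incl h0) ((hubbardFermionInteraction 2 t U).meanEnergyObs 1) -
        (c : ℂ) • (1 : FermionOp Λ') -
        ∑ σ : Fin 2, ((μ σ : ℝ) : ℂ) • (nAt 0 hz σ - ((ν : ℝ) : ℂ) • (1 : FermionOp Λ')) =
      gramForm Λm O +
        (∑ k ∈ s, ((hubbardFermionInteraction 2 t U).localHamiltonian Λ' * fermionEmbed (PolySite.incl hΛ) (B k) -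
            fermionEmbed (PolySite.incl hΛ) (B k) * (hubbardFermionInteraction 2 t U).localHamiltonian Λ') +
          ∑ l ∈ tt, (fermionEmbed (PolySite.incl (hsh l)) (fermionEmbed (PolySite.shiftEmb (v l) Λ) (Y l)) -
            fermionEmbed (PolySite.incl hΛ) (Y l)) +
          ∑ j ∈ u, b j • ladderWord (cw j)) +
        (∑ m' ∈ ah, ((dc m' : ℝ) : ℂ) • ((V m')ᴴ - V m') + ∑ k ∈ w, a k • ladderWord (word k))) :
    c - ∑ k ∈ w, ‖a k‖ + (∑ σ : Fin 2, μ σ) * ((nh : ℝ) / 12 - ν) ≤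
      (homHubbardMag crtHom43 (fun _ => κt) t U).minEnergyOn (szSector (2 * nh) 0) / 12 := by
  have hInj' : Set.InjOn crtHom43 ↑Λ' :=
    injOn_ringHom_two_of_spread 12 ![9, 4] (M₀ := 3) (M₁ := 2)
      (fun a' b' h₁ h₂ h₃ h₄ h₅ => by
        simp only [Matrix.cons_val_zero, Matrix.cons_val_one] at h₅
        omega) hspread
  have hd : Function.Injective (signedHop crtHom43) := injective_signedHop_ringHom 12 ![9, 4] (by decide)
  have h := homTorusTwist_minEnergyOn_div_ge_of_window_certificate crtHom43 t U κt hd hn hΛ hclosed h0 hz hInj'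
    μ ν hΛm O s B tt v hsh Y u b cw hcw ah dc V w a word hcert
  simp only [Nat.cast_ofNat, pow_one] at h
  exact h

end TwistedCRTTransposed

end Summit.Ventures.CertifiedManyBodySolver.Rows

end
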